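import Literature.MathematicalPhysics.KineticTheory.GoodConfigurations
import Literature.MathematicalPhysics.KineticTheory.PostCollisionGeometry
import HarnessLib

/-!
# The measure of the post-collisional bad set of BGSR Proposition 5.1

(Bodineau–Gallagher–Saint-Raymond, Invent. Math. 203 (2016) = arXiv:1305.3397v2, Proposition 5.1,
(5.9), post-collisional case; Gallagher–Saint-Raymond–Texier 2013, §12.3.2 and Lemma 12.2.2; trunk
T-KINETIC, topic MathematicalPhysics/KineticTheory; completes the formalisation of BGSR Prop. 5.1
begun in `GoodConfigurations` (avoidance, both cases; measure of the pre-collisional set) with the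
tools of `PostCollisionGeometry` (honest substitutes for GSRT Lemma 12.2.2), toward the named fact
`bgsr_linearBoltzmannApprox` (`TaggedSphereLinearBoltzmannRate`).)

BGSR Proposition 5.1 (p. 17): *"there is a subset `B_k^{m_k}(Z_k⁰)` of `S^{d-1} × B_E` of small
measure `|B_k^{m_k}(Z_k⁰)| ≤ C k (E^d (ā/ε₀)^{d-1} + E^d (Et)^d ε₀^{d-1} + E (ε₀/δ)^{d-1})`
(5.9)"*; for the post-collisional half GSRT §12.3.2 take `B_k^+(Z̄_k) := S^{d-1} × B_η(v̄_k) ∪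
⋃_{j ≤ k-1} N*(v̄_j, x̄_j - x̄_k, 6Ra/ε₀ + 6ε₀/δ)(v̄_k)` and quote Lemma 12.2.2,
`|N*(w, y, ρ)(v₁)| ≤ C_d R ρ^{d-1}`, for *"`|B_k^+(Z̄_k)| ≤ C k (η^d + R^d (a/ε₀)^{d-1} +
R (ε₀/δ)^{d-1})`"*.

This file PROVES, for the set `bgsrPostBadSet t ā ε₀ δ W Y m` of `GoodConfigurations` (GSRT's
`B_k^+` on the torus, through `reflectVel`) cut by `‖v‖ ≤ E` and measured by
`sphereMeasure ⊗ volume` (the measure of the hierarchy's collision term `hsCollisionTerm`):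

* `reflectVel_fst_sub_eq`, `reflectVel_snd_sub_eq`, `reflectVel_snd_sub_fst_eq` — on the unit
  sphere of deflection angles, `v_m* - v_j = (v_m - v_j) + ⟪v - v_m, ω⟫ ω`,
  `v* - v_j = ((v - v_m) - ⟪v - v_m, ω⟫ ω) + (v_m - v_j)`, `v* - v_m* = (v - v_m) - 2⟪v - v_m, ω⟫ ω`
  — the three shapes treated in `PostCollisionGeometry`.
* `bgsrConeSet_subset_cyls`, `bgsrDeltaSet_subset_cyls`, `bgsrWrapSet_subset_cyls` — Lemma 5.2's
  `K` (slack `ā`: `6ā ≤ ε₀ ≤ d(y₁, y₂)`, `ā ≤ 1/12`), `K_δ` and the wrap-around cones are covered by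
  at most `(2tW + 2)^d` (resp. `+ 1`) cylinders through the origin with unit axes and radius
  `6āW/ε₀ + 12āW`, resp. `3ε₀/δ + 12ε₀W`, resp. `12ε₀W` (`cone_subset_cyl`, `tube_subset_cyl`,
  the nearest image having length `≥ ε₀` and the others `≥ 1/2`).
* `sphereMeasure_prod_bgsrPostBadSet_le` — **the bound**: for `0 < ā`, `12ā ≤ ε₀ ≤ 1/12`,
  `0 < δ, W, E, λ`, `0 ≤ t`, `d ≥ 2` and the partner `m` `ε₀`-separated from the other particles,
  `(σ ⊗ dv){(ν, v) : ‖v‖ ≤ E, (ν, v) ∈ bgsrPostBadSet} ≤ d [(3ε₀/δ)^d + 2^{d+3} (P E^{d-1} ρ₃ +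
  2k (P (λE^d + E^{d-1} ρ₁/λ) + (P + 1)(λE^d + E^{d-1} ρ₂/λ)))] |B₁|²`, `P = (2tW + 2)^d`,
  `ρ₁ = 6(2ā)W/ε₀ + 12(2ā)W`, `ρ₂ = 3ε₀/δ + 12ε₀W`, `ρ₃ = 12ε₀W` (slow ball; reflected relative
  velocity in a wrap-around cone, `toSphere_prod_reflect_cyl_le`; for `j ≠ m`, `v_m*` in `K` or
  `K_δ`, `toSphere_prod_innerSmul_cyl_le`, and `v*` in `K` or `K_δ`, `toSphere_prod_orthProj_cyl_le`).

* `bgsrBadSet t ā ε₀ δ W Y m` — BGSR's `B_k^{m_k}(Z_k⁰)` as one set of pairs `(ν, v)` (the union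
  of `{v ∈ bgsrPreBadVel}` and `bgsrPostBadSet`; `not_mem_bgsrBadSet_iff`), and
  `sphereMeasure_prod_bgsrBadSet_le` — **(5.9) in full**: the sum of the pre-collisional bound
  `volume_bgsrPreBadVel_le` (times `σ(S^{d-1}) = d |B₁|`) and of the post-collisional one.

On the rate. With `λ ≍ (ρ/E)^{1/2}` the bound is `O(d 2^d k P E^{d-1/2} ρ^{1/2} |B₁|²)`,
`ρ = max ρᵢ`, which tends to `0` in the regime (5.8) (`ā ≪ ε₀ ≪ min(δE, 1)`, `ε₀ E ≪ 1`); it is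
weaker than the printed `(ā/ε₀)^{d-1}`-type rate, which for the post-collisional half rests on the
solid-angle claim of GSRT Lemma 12.2.2 (not uniform in the position of the cylinder, see the
module docstring of `PostCollisionGeometry`). Any positive power of the small parameters suffices
in BGSR's proof of Proposition 5.8, where `ā, ε₀, δ` are chosen as powers of `ε` and `E ≍ √|log ε|`.

## References

* T. Bodineau, I. Gallagher, L. Saint-Raymond, *The Brownian motion as the limit of a
  deterministic system of hard-spheres*, Invent. Math. 203 (2016) 493–553 = arXiv:1305.3397v2,
  Proposition 5.1, (5.8)–(5.9) (p. 17 of the held text), proof of Proposition 5.8 (p. 21).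
* I. Gallagher, L. Saint-Raymond, B. Texier, *From Newton to Boltzmann: hard spheres and
  short-range potentials*, EMS (2013), arXiv:1208.5753, Lemma 12.2.2, §12.3.2.
-/

open MeasureTheory Metric Set
open scoped InnerProductSpace

namespace Literature.MathematicalPhysics.KineticTheory

noncomputable section

open Literature.Analysis.FunctionSpaces Literature.Analysis.FunctionSpaces.Torus
open Literature.Analysis.FluidPDE Literature.Analysis.FluidPDE.Torus

variable {d : Type*} [Fintype d] [DecidableEq d]

/-! ## The scattered velocities on the unit sphere of deflection angles -/

section ReflectIdentities

omit [DecidableEq d] in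
/-- `v_m* - v_j = (v_m - v_j) + ⟪v - v_m, ω⟫ ω` for a unit deflection angle. [folklore] -/
theorem reflectVel_fst_sub_eq {ω : EuclideanSpace ℝ d} (hω : ‖ω‖ = 1)
    (vm v vj : EuclideanSpace ℝ d) :
    (reflectVel ω (vm, v)).1 - vj = (vm - vj) + ⟪v - vm, ω⟫_ℝ • ω := by
  have h : ⟪vm - v, ω⟫_ℝ = -⟪v - vm, ω⟫_ℝ := by rw [← neg_sub, inner_neg_left]
  simp only [reflectVel, hω, one_pow, div_one, h, neg_smul]
  abel

omit [DecidableEq d] in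
/-- `v* - v_j = ((v - v_m) - ⟪v - v_m, ω⟫ ω) + (v_m - v_j)` for a unit deflection angle.
[folklore] -/
theorem reflectVel_snd_sub_eq {ω : EuclideanSpace ℝ d} (hω : ‖ω‖ = 1)
    (vm v vj : EuclideanSpace ℝ d) :
    (reflectVel ω (vm, v)).2 - vj = (v - vm) - ⟪v - vm, ω⟫_ℝ • ω + (vm - vj) := by
  have h : ⟪vm - v, ω⟫_ℝ = -⟪v - vm, ω⟫_ℝ := by rw [← neg_sub, inner_neg_left]
  simp only [reflectVel, hω, one_pow, div_one, h, neg_smul]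
  abel

omit [DecidableEq d] in
/-- `v* - v_m* = (v - v_m) - 2⟪v - v_m, ω⟫ ω (+ 0)` for a unit deflection angle. [folklore] -/
theorem reflectVel_snd_sub_fst_eq {ω : EuclideanSpace ℝ d} (hω : ‖ω‖ = 1)
    (vm v : EuclideanSpace ℝ d) :
    (reflectVel ω (vm, v)).2 - (reflectVel ω (vm, v)).1 =
      (v - vm) - (2 * ⟪v - vm, ω⟫_ℝ) • ω + 0 := by
  have h : ⟪vm - v, ω⟫_ℝ = -⟪v - vm, ω⟫_ℝ := by rw [← neg_sub, inner_neg_left]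
  rw [reflectVel_snd_sub_fst hω, h, mul_neg, neg_smul, add_zero, ← sub_eq_add_neg]

end ReflectIdentities

/-! ## Lemma 5.2's sets are finite unions of thin cylinders -/

section Envelopes

/-- The cone set `K` of Lemma 5.2 (slack `ā`, `0 < ā ≤ 1/12`, `6ā ≤ ε₀ ≤ d(y₁, y₂)`, `0 < W`,
`0 ≤ t`) lies in at most `(2tW + 2)^d` cylinders through the origin of radius
`6āW/ε₀ + 12āW` (`cone_subset_cyl`: the nearest image has length `≥ ε₀`, the others `≥ 1/2`).
[cite: GallagherSaintRaymondTexier2013, Lemma 12.2.1] -/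
theorem bgsrConeSet_subset_cyls {t ā ε₀ W : ℝ} (hā : 0 < ā) (hā12 : ā ≤ 1 / 12) (hW : 0 < W)
    (ht : 0 ≤ t) {y₁ y₂ : UnitAddTorus d} (hε₀ : 6 * ā ≤ ε₀) (hsep : ε₀ ≤ euclidDist y₁ y₂) :
    ∃ (S : Finset (d → ℤ)) (e : (d → ℤ) → EuclideanSpace ℝ d),
      (S.card : ℝ) ≤ (2 * (t * W) + 2) ^ Fintype.card d ∧ (∀ k ∈ S, ‖e k‖ = 1) ∧
      bgsrConeSet t ā W (y₁ - y₂) ⊆ ⋃ k ∈ S, {w : EuclideanSpace ℝ d |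
        ‖w - ⟪w, e k⟫_ℝ • e k‖ ≤ 6 * ā * W / ε₀ + 12 * ā * W} := by
  classical
  set p₀ := reprSym (y₁ - y₂) with hp₀_def
  set ρ : ℝ := t * W + 3 * ā with hρ_def
  have hρ0 : 0 ≤ ρ := by positivity
  have hfin := finite_setOf_norm_add_latticeVec_le p₀ ρ
  refine ⟨hfin.toFinset, fun k => ‖p₀ + latticeVec k‖⁻¹ • (p₀ + latticeVec k), ?_, ?_, ?_⟩
  · have hsub : hfin.toFinset ⊆ Fintype.piFinset fun i => Finset.Icc ⌈-p₀ i - ρ⌉ ⌊-p₀ i + ρ⌋ := by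
      rw [Set.Finite.toFinset_subset]
      exact setOf_norm_add_latticeVec_le_subset p₀ ρ
    calc ((hfin.toFinset).card : ℝ)
        ≤ (Fintype.piFinset fun i => Finset.Icc ⌈-p₀ i - ρ⌉ ⌊-p₀ i + ρ⌋).card := by
          exact_mod_cast Finset.card_le_card hsub
      _ ≤ (2 * ρ + 1) ^ Fintype.card d := card_piFinset_Icc_le p₀ hρ0
      _ ≤ (2 * (t * W) + 2) ^ Fintype.card d := by
          apply pow_le_pow_left₀ (by positivity)
          rw [hρ_def]
          linarith
  · intro k _
    refine norm_inv_norm_smul fun h0 => ?_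
    by_cases hk : k = 0
    · rw [hk, latticeVec_zero, add_zero] at h0
      have : euclidDist y₁ y₂ = 0 := by rw [euclidDist_eq, ← hp₀_def, h0, norm_zero]
      linarith
    · have h := half_le_norm_reprSym_add_latticeVec (y₁ - y₂) hk
      rw [← hp₀_def, h0, norm_zero] at h
      linarith
  · rintro w ⟨hwW, k, hk, u, hu, hur⟩
    refine mem_iUnion₂.2 ⟨k, by rw [Set.Finite.mem_toFinset]; exact hk, ?_⟩
    have hpk : 2 * (3 * ā) ≤ ‖p₀ + latticeVec k‖ := by
      by_cases hk0 : k = 0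
      · rw [hk0, latticeVec_zero, add_zero]
        calc 2 * (3 * ā) = 6 * ā := by ring
          _ ≤ ε₀ := hε₀
          _ ≤ ‖p₀‖ := hsep
      · linarith [half_le_norm_reprSym_add_latticeVec (y₁ - y₂) hk0]
    have hmem := cone_subset_cyl (by positivity : 0 < 3 * ā) hpk hW ⟨hwW, u, hu, hur⟩
    simp only [mem_setOf_eq] at hmem ⊢
    refine hmem.trans ?_
    -- `2 · 3ā · W / ‖p₀ + k‖ ≤ 6āW/ε₀ + 12āW`
    have hpos : 0 < ‖p₀ + latticeVec k‖ := by linarith [hpk]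
    have hε₀0 : 0 < ε₀ := by linarith
    by_cases hk0 : k = 0
    · have hge : ε₀ ≤ ‖p₀ + latticeVec k‖ := by
        rw [hk0, latticeVec_zero, add_zero]
        exact hsep
      calc 2 * (3 * ā) * W / ‖p₀ + latticeVec k‖ ≤ 2 * (3 * ā) * W / ε₀ :=
            div_le_div_of_nonneg_left (by positivity) hε₀0 hge
        _ = 6 * ā * W / ε₀ := by ring
        _ ≤ 6 * ā * W / ε₀ + 12 * ā * W := by linarith [mul_pos hā hW]
    · have hge : (1 / 2 : ℝ) ≤ ‖p₀ + latticeVec k‖ := half_le_norm_reprSym_add_latticeVec _ hk0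
      calc 2 * (3 * ā) * W / ‖p₀ + latticeVec k‖ ≤ 2 * (3 * ā) * W / (1 / 2) :=
            div_le_div_of_nonneg_left (by positivity) (by norm_num) hge
        _ = 12 * ā * W := by ring
        _ ≤ 6 * ā * W / ε₀ + 12 * ā * W := by
            have : 0 ≤ 6 * ā * W / ε₀ := by positivity
            linarith

/-- The delayed set `K_δ` of Lemma 5.2 (`0 < ε₀ ≤ 1/12`, `ε₀ ≤ d(y₁, y₂)`, `0 < δ`, `0 < W`,
`0 ≤ t`) lies in at most `(2tW + 2)^d + 1` cylinders through the origin of radius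
`3ε₀/δ + 12ε₀W` (the tube `tube_subset_cyl` around the nearest image and the far cones
`cone_subset_cyl`). [cite: BodineauGallagherSaintRaymondInvent2016, Lemma 5.2 and Appendix B] -/
theorem bgsrDeltaSet_subset_cyls {t ε₀ δ W : ℝ} (hε₀ : 0 < ε₀) (hε₀12 : ε₀ ≤ 1 / 12)
    (hδ : 0 < δ) (hW : 0 < W) (ht : 0 ≤ t) {y₁ y₂ : UnitAddTorus d}
    (hsep : ε₀ ≤ euclidDist y₁ y₂) :
    ∃ (S : Finset (d → ℤ)) (e : (d → ℤ) → EuclideanSpace ℝ d),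
      (S.card : ℝ) ≤ (2 * (t * W) + 2) ^ Fintype.card d + 1 ∧ (∀ k ∈ S, ‖e k‖ = 1) ∧
      bgsrDeltaSet t ε₀ δ W (y₁ - y₂) ⊆ ⋃ k ∈ S, {w : EuclideanSpace ℝ d |
        ‖w - ⟪w, e k⟫_ℝ • e k‖ ≤ 3 * ε₀ / δ + 12 * ε₀ * W} := by
  classical
  set p₀ := reprSym (y₁ - y₂) with hp₀_def
  set ρ : ℝ := t * W + 3 * ε₀ with hρ_def
  have hρ0 : 0 ≤ ρ := by positivity
  have hp₀0 : p₀ ≠ 0 := by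
    intro h0
    have : euclidDist y₁ y₂ = 0 := by rw [euclidDist_eq, ← hp₀_def, h0, norm_zero]
    linarith
  have hfin := finite_setOf_norm_add_latticeVec_le p₀ ρ
  have hcyl0 : 0 ≤ 12 * ε₀ * W := by positivity
  have htube0 : 0 ≤ 3 * ε₀ / δ := by positivity
  refine ⟨insert 0 hfin.toFinset, fun k => ‖p₀ + latticeVec k‖⁻¹ • (p₀ + latticeVec k),
    ?_, ?_, ?_⟩
  · have hsub : hfin.toFinset ⊆ Fintype.piFinset fun i => Finset.Icc ⌈-p₀ i - ρ⌉ ⌊-p₀ i + ρ⌋ := by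
      rw [Set.Finite.toFinset_subset]
      exact setOf_norm_add_latticeVec_le_subset p₀ ρ
    have hcard : ((hfin.toFinset).card : ℝ) ≤ (2 * (t * W) + 2) ^ Fintype.card d := by
      calc ((hfin.toFinset).card : ℝ)
          ≤ (Fintype.piFinset fun i => Finset.Icc ⌈-p₀ i - ρ⌉ ⌊-p₀ i + ρ⌋).card := by
            exact_mod_cast Finset.card_le_card hsub
        _ ≤ (2 * ρ + 1) ^ Fintype.card d := card_piFinset_Icc_le p₀ hρ0
        _ ≤ (2 * (t * W) + 2) ^ Fintype.card d := by
            apply pow_le_pow_left₀ (by positivity)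
            rw [hρ_def]
            linarith
    have := Finset.card_insert_le 0 hfin.toFinset
    calc ((insert 0 hfin.toFinset).card : ℝ) ≤ (hfin.toFinset).card + 1 := by exact_mod_cast this
      _ ≤ _ := by linarith
  · intro k _
    refine norm_inv_norm_smul fun h0 => ?_
    by_cases hk : k = 0
    · rw [hk, latticeVec_zero, add_zero] at h0
      exact hp₀0 h0
    · have h := half_le_norm_reprSym_add_latticeVec (y₁ - y₂) hk
      rw [← hp₀_def, h0, norm_zero] at h
      linarith
  · rintro w ⟨hwW, htube | ⟨k, hk, hkρ, u, hu, hur⟩⟩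
    · refine mem_iUnion₂.2 ⟨0, Finset.mem_insert_self _ _, ?_⟩
      have hmem := tube_subset_cyl hp₀0 hδ (r := 3 * ε₀) htube
      simp only [latticeVec_zero, add_zero, mem_setOf_eq] at hmem ⊢
      exact hmem.trans (by linarith)
    · refine mem_iUnion₂.2 ⟨k, Finset.mem_insert_of_mem (by rw [Set.Finite.mem_toFinset]; exact hkρ),
        ?_⟩
      have hge : (1 / 2 : ℝ) ≤ ‖p₀ + latticeVec k‖ := half_le_norm_reprSym_add_latticeVec _ hk
      have hpk : 2 * (3 * ε₀) ≤ ‖p₀ + latticeVec k‖ := by linarith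
      have hmem := cone_subset_cyl (by positivity : 0 < 3 * ε₀) hpk hW ⟨hwW, u, hu, hur⟩
      simp only [mem_setOf_eq] at hmem ⊢
      refine hmem.trans ?_
      calc 2 * (3 * ε₀) * W / ‖p₀ + latticeVec k‖ ≤ 2 * (3 * ε₀) * W / (1 / 2) :=
            div_le_div_of_nonneg_left (by positivity) (by norm_num) hge
        _ = 12 * ε₀ * W := by ring
        _ ≤ 3 * ε₀ / δ + 12 * ε₀ * W := by linarith

/-- The wrap-around cones (`0 < ε₀ ≤ 1/12`, `0 < W`, `0 ≤ t`) lie in at most `(2tW + 2)^d`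
cylinders through the origin, of axes the nonzero lattice points within reach and radius
`12ε₀W`. [cite: BodineauGallagherSaintRaymondInvent2016, Appendix B] -/
theorem bgsrWrapSet_subset_cyls {t ε₀ W : ℝ} (hε₀ : 0 < ε₀) (hε₀12 : ε₀ ≤ 1 / 12) (hW : 0 < W)
    (ht : 0 ≤ t) :
    ∃ (S : Finset (d → ℤ)) (e : (d → ℤ) → EuclideanSpace ℝ d),
      (S.card : ℝ) ≤ (2 * (t * W) + 2) ^ Fintype.card d ∧ (∀ k ∈ S, ‖e k‖ = 1) ∧
      bgsrWrapSet d t ε₀ W ⊆ ⋃ k ∈ S, {w : EuclideanSpace ℝ d |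
        ‖w - ⟪w, e k⟫_ℝ • e k‖ ≤ 12 * ε₀ * W} := by
  classical
  set ρ : ℝ := t * W + 3 * ε₀ with hρ_def
  have hρ0 : 0 ≤ ρ := by positivity
  have hfin := finite_setOf_norm_add_latticeVec_le (0 : EuclideanSpace ℝ d) ρ
  have hnorm : ∀ k : d → ℤ, k ≠ 0 → (1 / 2 : ℝ) ≤ ‖(latticeVec k : EuclideanSpace ℝ d)‖ := by
    intro k hk
    have h := half_le_norm_reprSym_add_latticeVec (0 : UnitAddTorus d) hk
    rwa [reprSym_zero, zero_add] at h
  refine ⟨hfin.toFinset.erase 0,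
    fun k => ‖(latticeVec k : EuclideanSpace ℝ d)‖⁻¹ • (latticeVec k : EuclideanSpace ℝ d),
    ?_, ?_, ?_⟩
  · have hsub : hfin.toFinset ⊆ Fintype.piFinset fun i =>
        Finset.Icc ⌈-(0 : EuclideanSpace ℝ d) i - ρ⌉ ⌊-(0 : EuclideanSpace ℝ d) i + ρ⌋ := by
      rw [Set.Finite.toFinset_subset]
      exact setOf_norm_add_latticeVec_le_subset (0 : EuclideanSpace ℝ d) ρ
    calc ((hfin.toFinset.erase 0).card : ℝ) ≤ (hfin.toFinset).card := by
          exact_mod_cast Finset.card_erase_le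
      _ ≤ (Fintype.piFinset fun i =>
          Finset.Icc ⌈-(0 : EuclideanSpace ℝ d) i - ρ⌉ ⌊-(0 : EuclideanSpace ℝ d) i + ρ⌋).card := by
          exact_mod_cast Finset.card_le_card hsub
      _ ≤ (2 * ρ + 1) ^ Fintype.card d := card_piFinset_Icc_le (0 : EuclideanSpace ℝ d) hρ0
      _ ≤ (2 * (t * W) + 2) ^ Fintype.card d := by
          apply pow_le_pow_left₀ (by positivity)
          rw [hρ_def]
          linarith
  · intro k hk
    refine norm_inv_norm_smul fun h0 => ?_
    have hk0 : k ≠ 0 := (Finset.mem_erase.1 hk).1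
    have h := hnorm k hk0
    rw [h0, norm_zero] at h
    linarith
  · rintro w ⟨hwW, k, hk, hkρ, u, hu, hur⟩
    refine mem_iUnion₂.2 ⟨k, Finset.mem_erase.2 ⟨hk, ?_⟩, ?_⟩
    · rw [Set.Finite.mem_toFinset, mem_setOf_eq, zero_add]
      exact hkρ
    · have hge := hnorm k hk
      have hpk : 2 * (3 * ε₀) ≤ ‖(latticeVec k : EuclideanSpace ℝ d)‖ := by linarith
      have hmem := cone_subset_cyl (by positivity : 0 < 3 * ε₀) hpk hW ⟨hwW, u, hu, hur⟩
      simp only [mem_setOf_eq] at hmem ⊢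
      refine hmem.trans ?_
      calc 2 * (3 * ε₀) * W / ‖(latticeVec k : EuclideanSpace ℝ d)‖ ≤ 2 * (3 * ε₀) * W / (1 / 2) :=
            div_le_div_of_nonneg_left (by positivity) (by norm_num) hge
        _ = 12 * ε₀ * W := by ring

end Envelopes


/-! ## The measure of the post-collisional bad set -/

section PostMeasure

omit [Fintype d] [DecidableEq d] in
/-- Sub-additivity over a finite family of target sets. [folklore] -/
private theorem measure_inter_preimage_biUnion_le {α ι β : Type*} [MeasurableSpace α]
    (ν : Measure α) (S : Finset ι) (T : Set α) (Φ : α → β) (C : ι → Set β) {B : ENNReal}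
    (hB : ∀ i ∈ S, ν (T ∩ {a | Φ a ∈ C i}) ≤ B) :
    ν (T ∩ {a | Φ a ∈ ⋃ i ∈ S, C i}) ≤ S.card * B := by
  have h : T ∩ {a | Φ a ∈ ⋃ i ∈ S, C i} ⊆ ⋃ i ∈ S, (T ∩ {a | Φ a ∈ C i}) := by
    rintro a ⟨haT, ha⟩
    obtain ⟨i, hi, hai⟩ := mem_iUnion₂.1 ha
    exact mem_iUnion₂.2 ⟨i, hi, haT, hai⟩
  calc ν _ ≤ ν (⋃ i ∈ S, (T ∩ {a | Φ a ∈ C i})) := measure_mono h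
    _ ≤ ∑ i ∈ S, ν (T ∩ {a | Φ a ∈ C i}) := measure_biUnion_finset_le _ _
    _ ≤ ∑ _i ∈ S, B := Finset.sum_le_sum hB
    _ = S.card * B := by rw [Finset.sum_const, nsmul_eq_mul]

omit [Fintype d] [DecidableEq d] in
/-- Bookkeeping: `card · (x B) ≤ (P x) B` in `ℝ≥0∞` when `card ≤ P`, `0 ≤ x`. [folklore] -/
private theorem card_mul_ofReal_le {c : ℕ} {P x : ℝ} (hc : (c : ℝ) ≤ P) (hx : 0 ≤ x)
    (B : ENNReal) : (c : ENNReal) * (ENNReal.ofReal x * B) ≤ ENNReal.ofReal (P * x) * B := by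
  rw [← mul_assoc, ← ENNReal.ofReal_natCast, ← ENNReal.ofReal_mul c.cast_nonneg]
  exact mul_le_mul_of_nonneg_right (ENNReal.ofReal_le_ofReal
    (mul_le_mul_of_nonneg_right hc hx)) bot_le

/-- **BGSR Proposition 5.1, the measure of the post-collisional bad set** ((5.9), second half;
GSRT §12.3.2 with Lemma 12.2.2 replaced by the honest bounds of `PostCollisionGeometry`). For
`0 < ā`, `12ā ≤ ε₀ ≤ 1/12`, `0 < δ, W, E, λ`, `0 ≤ t`, `d ≥ 2`, and the partner `m`
`ε₀`-separated from the other particles of `Y`, the set of deflection angles and velocities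
`(ν, v) ∈ S^{d-1} × B_E` in `bgsrPostBadSet t ā ε₀ δ W Y m` has `σ ⊗ dv`-measure
(`σ = sphereMeasure`, the surface measure of the hierarchy's collision term) at most
`d [(3ε₀/δ)^d + 2^{d+3} (P E^{d-1} ρ₃ + 2k (P (λE^d + E^{d-1} ρ₁/λ) + (P + 1)(λE^d +
E^{d-1} ρ₂/λ)))] |B₁|²` with `P = (2tW + 2)^d` (lattice translates within reach),
`ρ₁ = 6(2ā)W/ε₀ + 12(2ā)W` (cylinders enveloping Lemma 5.2's cones `K`), `ρ₂ = 3ε₀/δ + 12ε₀W`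
(tube and far cones of `K_δ`), `ρ₃ = 12ε₀W` (wrap-around cones): the slow ball, the reflected
relative velocity in a wrap-around cone (`toSphere_prod_reflect_cyl_le`), and for each `j ≠ m`
the scattered `v_m*` (`toSphere_prod_innerSmul_cyl_le`) or `v*` (`toSphere_prod_orthProj_cyl_le`)
in `K` or `K_δ`. Optimising `λ ≍ (ρ/E)^{1/2}` this is `O(k P E^{d-1/2} ρ^{1/2})` with
`ρ = max ρᵢ → 0` in BGSR's regime (5.8) — in place of the printed
`C k (E^d (ā/ε₀)^{d-1} + E^d (Et)^d ε₀^{d-1} + E (ε₀/δ)^{d-1})`, whose post-collisional half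
rests on the solid-angle claim of GSRT Lemma 12.2.2 (see `PostCollisionGeometry`).
[cite: BodineauGallagherSaintRaymondInvent2016, Proposition 5.1 (5.9)] -/
theorem sphereMeasure_prod_bgsrPostBadSet_le {k : ℕ} {t ā ε₀ δ W E lam : ℝ} (hā : 0 < ā)
    (hāε₀ : 12 * ā ≤ ε₀) (hε₀12 : ε₀ ≤ 1 / 12) (hδ : 0 < δ) (hW : 0 < W) (ht : 0 ≤ t)
    (hE : 0 < E) (hlam : 0 < lam) (hd : 2 ≤ Fintype.card d) {Y : Config k d (UnitAddTorus d)}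
    {m : Fin k} (hsep : ∀ j : Fin k, j ≠ m → ε₀ ≤ euclidDist (Y m).1 (Y j).1) :
    ((sphereMeasure (E := EuclideanSpace ℝ d)).prod volume)
        {p : sphere (0 : EuclideanSpace ℝ d) 1 × EuclideanSpace ℝ d |
          ‖p.2‖ ≤ E ∧ ((p.1 : EuclideanSpace ℝ d), p.2) ∈ bgsrPostBadSet t ā ε₀ δ W Y m} ≤
      ENNReal.ofReal (Fintype.card d * ((3 * ε₀ / δ) ^ Fintype.card d +
        2 ^ (Fintype.card d + 3) *
          ((2 * (t * W) + 2) ^ Fintype.card d * E ^ (Fintype.card d - 1) * (12 * ε₀ * W) +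
            2 * k * ((2 * (t * W) + 2) ^ Fintype.card d *
                (lam * E ^ Fintype.card d + E ^ (Fintype.card d - 1) *
                  ((6 * (2 * ā) * W / ε₀ + 12 * (2 * ā) * W) / lam)) +
              ((2 * (t * W) + 2) ^ Fintype.card d + 1) *
                (lam * E ^ Fintype.card d + E ^ (Fintype.card d - 1) *
                  ((3 * ε₀ / δ + 12 * ε₀ * W) / lam)))))) *
        volume (ball (0 : EuclideanSpace ℝ d) 1) ^ 2 := by
  classical
  set n := Fintype.card d with hn_def
  have hnE : Module.finrank ℝ (EuclideanSpace ℝ d) = n := finrank_euclideanSpace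
  have h2 : 2 ≤ Module.finrank ℝ (EuclideanSpace ℝ d) := by rw [hnE]; exact hd
  have hε₀ : 0 < ε₀ := by linarith
  set vm := (Y m).2 with hvm_def
  set P : ℝ := (2 * (t * W) + 2) ^ n with hP_def
  have hP0 : 0 ≤ P := by positivity
  set ρ₁ : ℝ := 6 * (2 * ā) * W / ε₀ + 12 * (2 * ā) * W with hρ₁_def
  set ρ₂ : ℝ := 3 * ε₀ / δ + 12 * ε₀ * W with hρ₂_def
  set ρ₃ : ℝ := 12 * ε₀ * W with hρ₃_def
  have hρ₁ : 0 < ρ₁ := by positivity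
  have hρ₂ : 0 < ρ₂ := by positivity
  have hρ₃ : 0 < ρ₃ := by positivity
  set B := volume (ball (0 : EuclideanSpace ℝ d) 1) with hB_def
  set μ₂ := ((sphereMeasure (E := EuclideanSpace ℝ d)).prod
    (volume : Measure (EuclideanSpace ℝ d))) with hμ₂_def
  have hσ : (sphereMeasure (E := EuclideanSpace ℝ d)) =
      (volume : Measure (EuclideanSpace ℝ d)).toSphere := rfl
  -- the real constants of the pieces
  set x₁ : ℝ := n * 2 ^ (n + 3) * (lam * E ^ n + E ^ (n - 1) * (ρ₁ / lam)) with hx₁_def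
  set x₂ : ℝ := n * 2 ^ (n + 3) * (lam * E ^ n + E ^ (n - 1) * (ρ₂ / lam)) with hx₂_def
  set x₃ : ℝ := n * 2 ^ (n + 3) * E ^ (n - 1) * ρ₃ with hx₃_def
  have hx₁0 : 0 ≤ x₁ := by positivity
  have hx₂0 : 0 ≤ x₂ := by positivity
  have hx₃0 : 0 ≤ x₃ := by positivity
  -- the pieces
  set T : Set (sphere (0 : EuclideanSpace ℝ d) 1 × EuclideanSpace ℝ d) := {p | ‖p.2 - 0‖ ≤ E}
    with hT_def
  set Φ₁ : Fin k → sphere (0 : EuclideanSpace ℝ d) 1 × EuclideanSpace ℝ d → EuclideanSpace ℝ d :=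
    fun j p => (vm - (Y j).2) + ⟪p.2 - vm, (p.1 : EuclideanSpace ℝ d)⟫_ℝ • (p.1 : EuclideanSpace ℝ d)
    with hΦ₁_def
  set Φ₂ : Fin k → sphere (0 : EuclideanSpace ℝ d) 1 × EuclideanSpace ℝ d → EuclideanSpace ℝ d :=
    fun j p => (p.2 - vm) - ⟪p.2 - vm, (p.1 : EuclideanSpace ℝ d)⟫_ℝ • (p.1 : EuclideanSpace ℝ d) +
      (vm - (Y j).2) with hΦ₂_def
  set Φ₃ : sphere (0 : EuclideanSpace ℝ d) 1 × EuclideanSpace ℝ d → EuclideanSpace ℝ d :=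
    fun p => (p.2 - vm) - (2 * ⟪p.2 - vm, (p.1 : EuclideanSpace ℝ d)⟫_ℝ) •
      (p.1 : EuclideanSpace ℝ d) + 0 with hΦ₃_def
  set K : Fin k → Set (EuclideanSpace ℝ d) := fun j => bgsrConeSet t (2 * ā) W ((Y m).1 - (Y j).1)
    with hK_def
  set Kδ : Fin k → Set (EuclideanSpace ℝ d) := fun j => bgsrDeltaSet t ε₀ δ W ((Y m).1 - (Y j).1)
    with hKδ_def
  set U : Fin k → Set (sphere (0 : EuclideanSpace ℝ d) 1 × EuclideanSpace ℝ d) := fun j =>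
    (T ∩ {p | Φ₁ j p ∈ K j} ∪ T ∩ {p | Φ₁ j p ∈ Kδ j}) ∪
      (T ∩ {p | Φ₂ j p ∈ K j} ∪ T ∩ {p | Φ₂ j p ∈ Kδ j}) with hU_def
  -- Step 1: the inclusion
  have hincl : {p : sphere (0 : EuclideanSpace ℝ d) 1 × EuclideanSpace ℝ d |
      ‖p.2‖ ≤ E ∧ ((p.1 : EuclideanSpace ℝ d), p.2) ∈ bgsrPostBadSet t ā ε₀ δ W Y m} ⊆
      (univ ×ˢ closedBall vm (3 * ε₀ / δ) ∪ T ∩ {p | Φ₃ p ∈ bgsrWrapSet d t ε₀ W}) ∪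
        ⋃ j : Fin k, {p | j ≠ m ∧ p ∈ U j} := by
    rintro ⟨ω, v⟩ ⟨hvE, hbad⟩
    have hω : ‖(ω : EuclideanSpace ℝ d)‖ = 1 := by simp
    have hvT : ((ω, v) : sphere (0 : EuclideanSpace ℝ d) 1 × EuclideanSpace ℝ d) ∈ T := by
      show ‖v - 0‖ ≤ E
      rwa [sub_zero]
    simp only [bgsrPostBadSet, mem_union, mem_iUnion, mem_setOf_eq] at hbad
    rcases hbad with (hball | hwrap) | ⟨j, hjm, hj⟩
    · exact Or.inl (Or.inl ⟨mem_univ _, mem_closedBall_iff_norm.2 hball⟩)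
    · refine Or.inl (Or.inr ⟨hvT, ?_⟩)
      show Φ₃ (ω, v) ∈ bgsrWrapSet d t ε₀ W
      rw [hΦ₃_def]
      simp only
      rw [← reflectVel_snd_sub_fst_eq hω]
      exact hwrap
    · refine Or.inr (mem_iUnion.2 ⟨j, hjm, ?_⟩)
      have e1 : (reflectVel (ω : EuclideanSpace ℝ d) (vm, v)).1 - (Y j).2 = Φ₁ j (ω, v) := by
        rw [hΦ₁_def, reflectVel_fst_sub_eq hω]
      have e2 : (reflectVel (ω : EuclideanSpace ℝ d) (vm, v)).2 - (Y j).2 = Φ₂ j (ω, v) := by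
        rw [hΦ₂_def, reflectVel_snd_sub_eq hω]
      rw [e1, e2] at hj
      rcases hj with (h | h) | (h | h)
      · exact Or.inl (Or.inl ⟨hvT, h⟩)
      · exact Or.inl (Or.inr ⟨hvT, h⟩)
      · exact Or.inr (Or.inl ⟨hvT, h⟩)
      · exact Or.inr (Or.inr ⟨hvT, h⟩)
  -- Step 2: the pieces
  have hball : μ₂ (univ ×ˢ closedBall vm (3 * ε₀ / δ)) ≤
      ENNReal.ofReal (n * (3 * ε₀ / δ) ^ n) * B ^ 2 := by
    refine (Measure.prod_prod_le _ _).trans (le_of_eq ?_)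
    rw [hσ, Measure.toSphere_apply_univ, hnE, Measure.addHaar_closedBall volume vm
      (by positivity : (0 : ℝ) ≤ 3 * ε₀ / δ), hnE, ← hB_def,
      ENNReal.ofReal_mul (Nat.cast_nonneg n), ENNReal.ofReal_natCast]
    ring
  have hwrap : μ₂ (T ∩ {p | Φ₃ p ∈ bgsrWrapSet d t ε₀ W}) ≤ ENNReal.ofReal (P * x₃) * B ^ 2 := by
    obtain ⟨S, e, hcard, he, hsub⟩ := bgsrWrapSet_subset_cyls (d := d) hε₀ hε₀12 hW ht
    have hstep : μ₂ (T ∩ {p | Φ₃ p ∈ bgsrWrapSet d t ε₀ W}) ≤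
        μ₂ (T ∩ {p | Φ₃ p ∈ ⋃ i ∈ S, {w : EuclideanSpace ℝ d | ‖w - ⟪w, e i⟫_ℝ • e i‖ ≤ ρ₃}}) :=
      measure_mono fun p hp => ⟨hp.1, hsub hp.2⟩
    refine hstep.trans ((measure_inter_preimage_biUnion_le μ₂ S T Φ₃
      (fun i => {w : EuclideanSpace ℝ d | ‖w - ⟪w, e i⟫_ℝ • e i‖ ≤ ρ₃}) fun i hi => ?_).trans
        (card_mul_ofReal_le hcard hx₃0 _))
    have h := toSphere_prod_reflect_cyl_le (volume : Measure (EuclideanSpace ℝ d)) (he i hi) 0 vm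
      0 hE hρ₃ h2
    rw [hnE] at h
    refine h.trans' (measure_mono fun p hp => ?_)
    exact ⟨hp.1, hp.2⟩
  have hU : ∀ j : Fin k, μ₂ {p | j ≠ m ∧ p ∈ U j} ≤
      ENNReal.ofReal (2 * (P * x₁ + (P + 1) * x₂)) * B ^ 2 := by
    intro j
    by_cases hjm : j = m
    · have hempty : {p : sphere (0 : EuclideanSpace ℝ d) 1 × EuclideanSpace ℝ d |
          j ≠ m ∧ p ∈ U j} = ∅ := by
        ext p
        simp [hjm]
      rw [hempty, measure_empty]
      exact bot_le
    · have hsub0 : {p : sphere (0 : EuclideanSpace ℝ d) 1 × EuclideanSpace ℝ d |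
          j ≠ m ∧ p ∈ U j} ⊆ U j := fun p hp => hp.2
      obtain ⟨S₁, e₁, hc₁, he₁, hsub₁⟩ := bgsrConeSet_subset_cyls (d := d) (ā := 2 * ā)
        (by positivity) (by linarith) hW ht (by linarith : 6 * (2 * ā) ≤ ε₀) (hsep j hjm)
      obtain ⟨S₂, e₂, hc₂, he₂, hsub₂⟩ := bgsrDeltaSet_subset_cyls (d := d) hε₀ hε₀12 hδ hW ht
        (hsep j hjm)
      set C₁ : (d → ℤ) → Set (EuclideanSpace ℝ d) := fun i =>
        {w | ‖w - ⟪w, e₁ i⟫_ℝ • e₁ i‖ ≤ ρ₁} with hC₁_def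
      set C₂ : (d → ℤ) → Set (EuclideanSpace ℝ d) := fun i =>
        {w | ‖w - ⟪w, e₂ i⟫_ℝ • e₂ i‖ ≤ ρ₂} with hC₂_def
      have hK : K j ⊆ ⋃ i ∈ S₁, C₁ i := hsub₁
      have hKδ : Kδ j ⊆ ⋃ i ∈ S₂, C₂ i := hsub₂
      -- the four sub-pieces
      have h11 : μ₂ (T ∩ {p | Φ₁ j p ∈ K j}) ≤ ENNReal.ofReal (P * x₁) * B ^ 2 := by
        have hstep : μ₂ (T ∩ {p | Φ₁ j p ∈ K j}) ≤ μ₂ (T ∩ {p | Φ₁ j p ∈ ⋃ i ∈ S₁, C₁ i}) :=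
          measure_mono fun p hp => ⟨hp.1, hK hp.2⟩
        refine hstep.trans ((measure_inter_preimage_biUnion_le μ₂ S₁ T (Φ₁ j) C₁
          fun i hi => ?_).trans (card_mul_ofReal_le hc₁ hx₁0 _))
        have h := toSphere_prod_innerSmul_cyl_le (volume : Measure (EuclideanSpace ℝ d)) (he₁ i hi)
          (vm - (Y j).2) vm 0 hE hρ₁ hlam h2
        rw [hnE] at h
        refine h.trans' (measure_mono fun p hp => ?_)
        exact ⟨hp.1, hp.2⟩
      have h12 : μ₂ (T ∩ {p | Φ₁ j p ∈ Kδ j}) ≤ ENNReal.ofReal ((P + 1) * x₂) * B ^ 2 := by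
        have hstep : μ₂ (T ∩ {p | Φ₁ j p ∈ Kδ j}) ≤ μ₂ (T ∩ {p | Φ₁ j p ∈ ⋃ i ∈ S₂, C₂ i}) :=
          measure_mono fun p hp => ⟨hp.1, hKδ hp.2⟩
        refine hstep.trans ((measure_inter_preimage_biUnion_le μ₂ S₂ T (Φ₁ j) C₂
          fun i hi => ?_).trans (card_mul_ofReal_le hc₂ hx₂0 _))
        have h := toSphere_prod_innerSmul_cyl_le (volume : Measure (EuclideanSpace ℝ d)) (he₂ i hi)
          (vm - (Y j).2) vm 0 hE hρ₂ hlam h2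
        rw [hnE] at h
        refine h.trans' (measure_mono fun p hp => ?_)
        exact ⟨hp.1, hp.2⟩
      have h21 : μ₂ (T ∩ {p | Φ₂ j p ∈ K j}) ≤ ENNReal.ofReal (P * x₁) * B ^ 2 := by
        have hstep : μ₂ (T ∩ {p | Φ₂ j p ∈ K j}) ≤ μ₂ (T ∩ {p | Φ₂ j p ∈ ⋃ i ∈ S₁, C₁ i}) :=
          measure_mono fun p hp => ⟨hp.1, hK hp.2⟩
        refine hstep.trans ((measure_inter_preimage_biUnion_le μ₂ S₁ T (Φ₂ j) C₁
          fun i hi => ?_).trans (card_mul_ofReal_le hc₁ hx₁0 _))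
        have h := toSphere_prod_orthProj_cyl_le (volume : Measure (EuclideanSpace ℝ d)) (he₁ i hi)
          (vm - (Y j).2) vm 0 hE hρ₁ hlam h2
        rw [hnE] at h
        refine h.trans' (measure_mono fun p hp => ?_)
        exact ⟨hp.1, hp.2⟩
      have h22 : μ₂ (T ∩ {p | Φ₂ j p ∈ Kδ j}) ≤ ENNReal.ofReal ((P + 1) * x₂) * B ^ 2 := by
        have hstep : μ₂ (T ∩ {p | Φ₂ j p ∈ Kδ j}) ≤ μ₂ (T ∩ {p | Φ₂ j p ∈ ⋃ i ∈ S₂, C₂ i}) :=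
          measure_mono fun p hp => ⟨hp.1, hKδ hp.2⟩
        refine hstep.trans ((measure_inter_preimage_biUnion_le μ₂ S₂ T (Φ₂ j) C₂
          fun i hi => ?_).trans (card_mul_ofReal_le hc₂ hx₂0 _))
        have h := toSphere_prod_orthProj_cyl_le (volume : Measure (EuclideanSpace ℝ d)) (he₂ i hi)
          (vm - (Y j).2) vm 0 hE hρ₂ hlam h2
        rw [hnE] at h
        refine h.trans' (measure_mono fun p hp => ?_)
        exact ⟨hp.1, hp.2⟩
      calc μ₂ {p | j ≠ m ∧ p ∈ U j} ≤ μ₂ (U j) := measure_mono hsub0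
        _ ≤ μ₂ (T ∩ {p | Φ₁ j p ∈ K j} ∪ T ∩ {p | Φ₁ j p ∈ Kδ j}) +
              μ₂ (T ∩ {p | Φ₂ j p ∈ K j} ∪ T ∩ {p | Φ₂ j p ∈ Kδ j}) := measure_union_le _ _
        _ ≤ (ENNReal.ofReal (P * x₁) * B ^ 2 + ENNReal.ofReal ((P + 1) * x₂) * B ^ 2) +
              (ENNReal.ofReal (P * x₁) * B ^ 2 + ENNReal.ofReal ((P + 1) * x₂) * B ^ 2) :=
            add_le_add ((measure_union_le _ _).trans (add_le_add h11 h12))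
              ((measure_union_le _ _).trans (add_le_add h21 h22))
        _ = ENNReal.ofReal (2 * (P * x₁ + (P + 1) * x₂)) * B ^ 2 := by
            have ha : 0 ≤ P * x₁ := by positivity
            have hb : 0 ≤ (P + 1) * x₂ := by positivity
            rw [show 2 * (P * x₁ + (P + 1) * x₂) = (P * x₁ + (P + 1) * x₂) + (P * x₁ + (P + 1) * x₂)
              by ring, ENNReal.ofReal_add (by positivity) (by positivity), ENNReal.ofReal_add ha hb]
            ring
  -- Step 3: adding up
  have hsumU : μ₂ (⋃ j : Fin k, {p | j ≠ m ∧ p ∈ U j}) ≤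
      ENNReal.ofReal (k * (2 * (P * x₁ + (P + 1) * x₂))) * B ^ 2 := by
    calc μ₂ (⋃ j : Fin k, {p | j ≠ m ∧ p ∈ U j}) ≤ ∑ j : Fin k, μ₂ {p | j ≠ m ∧ p ∈ U j} :=
          measure_iUnion_fintype_le _ _
      _ ≤ ∑ _j : Fin k, ENNReal.ofReal (2 * (P * x₁ + (P + 1) * x₂)) * B ^ 2 :=
          Finset.sum_le_sum fun j _ => hU j
      _ = ENNReal.ofReal (k * (2 * (P * x₁ + (P + 1) * x₂))) * B ^ 2 := by
          rw [Finset.sum_const, Finset.card_univ, Fintype.card_fin, nsmul_eq_mul, ← mul_assoc,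
            ← ENNReal.ofReal_natCast, ← ENNReal.ofReal_mul (Nat.cast_nonneg k)]
  have htotal : μ₂ {p : sphere (0 : EuclideanSpace ℝ d) 1 × EuclideanSpace ℝ d |
      ‖p.2‖ ≤ E ∧ ((p.1 : EuclideanSpace ℝ d), p.2) ∈ bgsrPostBadSet t ā ε₀ δ W Y m} ≤
      ENNReal.ofReal (n * (3 * ε₀ / δ) ^ n + P * x₃ + k * (2 * (P * x₁ + (P + 1) * x₂))) * B ^ 2 := by
    calc _ ≤ μ₂ ((univ ×ˢ closedBall vm (3 * ε₀ / δ) ∪ T ∩ {p | Φ₃ p ∈ bgsrWrapSet d t ε₀ W}) ∪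
          ⋃ j : Fin k, {p | j ≠ m ∧ p ∈ U j}) := measure_mono hincl
      _ ≤ (μ₂ (univ ×ˢ closedBall vm (3 * ε₀ / δ)) + μ₂ (T ∩ {p | Φ₃ p ∈ bgsrWrapSet d t ε₀ W})) +
          μ₂ (⋃ j : Fin k, {p | j ≠ m ∧ p ∈ U j}) :=
          (measure_union_le _ _).trans (add_le_add (measure_union_le _ _) le_rfl)
      _ ≤ (ENNReal.ofReal (n * (3 * ε₀ / δ) ^ n) * B ^ 2 + ENNReal.ofReal (P * x₃) * B ^ 2) +
          ENNReal.ofReal (k * (2 * (P * x₁ + (P + 1) * x₂))) * B ^ 2 :=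
          add_le_add (add_le_add hball hwrap) hsumU
      _ = _ := by
          rw [ENNReal.ofReal_add (by positivity) (by positivity),
            ENNReal.ofReal_add (by positivity) (by positivity)]
          ring
  refine htotal.trans (le_of_eq ?_)
  congr 2
  rw [hx₁_def, hx₂_def, hx₃_def]
  ring

end PostMeasure


/-! ## BGSR's bad set `B_k^{m_k}(Z_k⁰)` as one object, and its total measure -/

section BadSet

/-- **BGSR's bad set `B_k^{m_k}(Z_k⁰)`** of Proposition 5.1 as ONE subset of
`ℝ^d × ℝ^d ∋ (ν, v)` (the sphere factor `ν ∈ S^{d-1}` is imposed by the measure): the pairs whose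
velocity is pre-collisionally bad (`bgsrPreBadVel`, GSRT's `B_k^-`, independent of `ν`) or which
are post-collisionally bad (`bgsrPostBadSet`, GSRT's `B_k^+`). Outside it, all the conclusions
(5.10)–(5.13) of Proposition 5.1 hold (`bgsr_prop51_pre_bbgky` … `bgsr_prop51_post_boltzmann_delta`,
through `not_mem_bgsrBadSet_iff`), according to the sign of `ν · (v - v_{m_k})` (the grazing
pairs `ν · (v - v_{m_k}) = 0` carry no weight in the collision integrals and need not be excluded).
[cite: BodineauGallagherSaintRaymondInvent2016, Proposition 5.1] -/
def bgsrBadSet {k : ℕ} (t ā ε₀ δ W : ℝ) (Y : Config k d (UnitAddTorus d)) (m : Fin k) :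
    Set (EuclideanSpace ℝ d × EuclideanSpace ℝ d) :=
  {p | p.2 ∈ bgsrPreBadVel t ā ε₀ δ W Y m} ∪ bgsrPostBadSet t ā ε₀ δ W Y m

/-- Avoiding `bgsrBadSet` is avoiding both halves. [folklore] -/
theorem not_mem_bgsrBadSet_iff {k : ℕ} {t ā ε₀ δ W : ℝ} {Y : Config k d (UnitAddTorus d)}
    {m : Fin k} {ω v : EuclideanSpace ℝ d} :
    (ω, v) ∉ bgsrBadSet t ā ε₀ δ W Y m ↔
      v ∉ bgsrPreBadVel t ā ε₀ δ W Y m ∧ (ω, v) ∉ bgsrPostBadSet t ā ε₀ δ W Y m := by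
  simp only [bgsrBadSet, mem_union, mem_setOf_eq, not_or]

/-- **BGSR Proposition 5.1, (5.9): the total measure of the bad set.** For `0 < ā`,
`12ā ≤ ε₀ ≤ 1/12`, `0 < δ`, `3ε₀/δ ≤ W`, `0 ≤ t`, `0 < E, λ`, `d ≥ 2` and the partner `m`
`ε₀`-separated from the other particles of `Y` (e.g. `Y ∈ 𝒢_k(ε₀)`), the `σ ⊗ dv`-measure
(`σ = sphereMeasure` on `S^{d-1}`) of `{(ν, v) : ‖v‖ ≤ E, (ν, v) ∈ bgsrBadSet}` is at most
`d [k (2·6^d W^d ((6ā/ε₀)^{d-1} + 3P (6ε₀)^{d-1}) + 4·2^d W (3ε₀/δ)^{d-1}) + (3ε₀/δ)^d +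
2^{d+3} (P E^{d-1} ρ₃ + 2k (P (λE^d + E^{d-1} ρ₁/λ) + (P+1)(λE^d + E^{d-1} ρ₂/λ)))] |B₁|²`,
`P = (2tW + 2)^d`, `ρ₁ = 6(2ā)W/ε₀ + 12(2ā)W`, `ρ₂ = 3ε₀/δ + 12ε₀W`, `ρ₃ = 12ε₀W` — the sum of
`volume_bgsrPreBadVel_le` (times `σ(S^{d-1}) = d |B₁|`) and `sphereMeasure_prod_bgsrPostBadSet_le`;
the printed `C k (E^d (ā/ε₀)^{d-1} + E^d (Et)^d ε₀^{d-1} + E (ε₀/δ)^{d-1})` up to the documented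
changes of rate. [cite: BodineauGallagherSaintRaymondInvent2016, Proposition 5.1 (5.9)] -/
theorem sphereMeasure_prod_bgsrBadSet_le {k : ℕ} {t ā ε₀ δ W E lam : ℝ} (hā : 0 < ā)
    (hāε₀ : 12 * ā ≤ ε₀) (hε₀12 : ε₀ ≤ 1 / 12) (hδ : 0 < δ) (hδW : 3 * ε₀ / δ ≤ W) (ht : 0 ≤ t)
    (hE : 0 < E) (hlam : 0 < lam) (hd : 2 ≤ Fintype.card d) {Y : Config k d (UnitAddTorus d)}
    {m : Fin k} (hsep : ∀ j : Fin k, j ≠ m → ε₀ ≤ euclidDist (Y m).1 (Y j).1) :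
    ((sphereMeasure (E := EuclideanSpace ℝ d)).prod volume)
        {p : sphere (0 : EuclideanSpace ℝ d) 1 × EuclideanSpace ℝ d |
          ‖p.2‖ ≤ E ∧ ((p.1 : EuclideanSpace ℝ d), p.2) ∈ bgsrBadSet t ā ε₀ δ W Y m} ≤
      ENNReal.ofReal (Fintype.card d * (k * (2 * 6 ^ Fintype.card d * W ^ Fintype.card d *
            ((6 * ā / ε₀) ^ (Fintype.card d - 1) +
              3 * (2 * (t * W) + 2) ^ Fintype.card d * (6 * ε₀) ^ (Fintype.card d - 1)) +
          4 * 2 ^ Fintype.card d * W * (3 * ε₀ / δ) ^ (Fintype.card d - 1)) +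
        ((3 * ε₀ / δ) ^ Fintype.card d + 2 ^ (Fintype.card d + 3) *
          ((2 * (t * W) + 2) ^ Fintype.card d * E ^ (Fintype.card d - 1) * (12 * ε₀ * W) +
            2 * k * ((2 * (t * W) + 2) ^ Fintype.card d *
                (lam * E ^ Fintype.card d + E ^ (Fintype.card d - 1) *
                  ((6 * (2 * ā) * W / ε₀ + 12 * (2 * ā) * W) / lam)) +
              ((2 * (t * W) + 2) ^ Fintype.card d + 1) *
                (lam * E ^ Fintype.card d + E ^ (Fintype.card d - 1) *
                  ((3 * ε₀ / δ + 12 * ε₀ * W) / lam))))))) *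
        volume (ball (0 : EuclideanSpace ℝ d) 1) ^ 2 := by
  set n := Fintype.card d with hn_def
  have hnE : Module.finrank ℝ (EuclideanSpace ℝ d) = n := finrank_euclideanSpace
  have hε₀ : 0 < ε₀ := by linarith
  have hW : 0 < W := lt_of_lt_of_le (by positivity) hδW
  set B := volume (ball (0 : EuclideanSpace ℝ d) 1) with hB_def
  set μ₂ := ((sphereMeasure (E := EuclideanSpace ℝ d)).prod
    (volume : Measure (EuclideanSpace ℝ d))) with hμ₂_def
  have hσ : (sphereMeasure (E := EuclideanSpace ℝ d)) =
      (volume : Measure (EuclideanSpace ℝ d)).toSphere := rfl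
  -- the two constants
  set cpre : ℝ := k * (2 * 6 ^ n * W ^ n * ((6 * ā / ε₀) ^ (n - 1) +
      3 * (2 * (t * W) + 2) ^ n * (6 * ε₀) ^ (n - 1)) + 4 * 2 ^ n * W * (3 * ε₀ / δ) ^ (n - 1))
    with hcpre_def
  set cpost : ℝ := n * ((3 * ε₀ / δ) ^ n + 2 ^ (n + 3) *
      ((2 * (t * W) + 2) ^ n * E ^ (n - 1) * (12 * ε₀ * W) +
        2 * k * ((2 * (t * W) + 2) ^ n *
            (lam * E ^ n + E ^ (n - 1) * ((6 * (2 * ā) * W / ε₀ + 12 * (2 * ā) * W) / lam)) +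
          ((2 * (t * W) + 2) ^ n + 1) *
            (lam * E ^ n + E ^ (n - 1) * ((3 * ε₀ / δ + 12 * ε₀ * W) / lam))))) with hcpost_def
  have hcpre0 : 0 ≤ cpre := by
    have : 0 ≤ 6 * ā / ε₀ := by positivity
    positivity
  have hcpost0 : 0 ≤ cpost := by positivity
  -- the split
  have hincl : {p : sphere (0 : EuclideanSpace ℝ d) 1 × EuclideanSpace ℝ d |
      ‖p.2‖ ≤ E ∧ ((p.1 : EuclideanSpace ℝ d), p.2) ∈ bgsrBadSet t ā ε₀ δ W Y m} ⊆
      univ ×ˢ bgsrPreBadVel t ā ε₀ δ W Y m ∪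
        {p | ‖p.2‖ ≤ E ∧ ((p.1 : EuclideanSpace ℝ d), p.2) ∈ bgsrPostBadSet t ā ε₀ δ W Y m} := by
    rintro p ⟨hpE, hpre | hpost⟩
    · exact Or.inl ⟨mem_univ _, hpre⟩
    · exact Or.inr ⟨hpE, hpost⟩
  have hpre : μ₂ (univ ×ˢ bgsrPreBadVel t ā ε₀ δ W Y m) ≤ ENNReal.ofReal (n * cpre) * B ^ 2 := by
    refine (Measure.prod_prod_le _ _).trans ?_
    have h1 := volume_bgsrPreBadVel_le hā hāε₀ hε₀12 hδ hδW ht (by omega : 1 ≤ Fintype.card d)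
      hsep (t := t)
    rw [hσ, Measure.toSphere_apply_univ, hnE]
    calc (n : ENNReal) * volume (ball (0 : EuclideanSpace ℝ d) 1) *
          volume (bgsrPreBadVel t ā ε₀ δ W Y m)
        ≤ (n : ENNReal) * B * (ENNReal.ofReal cpre * B) := mul_le_mul_of_nonneg_left h1 bot_le
      _ = ENNReal.ofReal (n * cpre) * B ^ 2 := by
          rw [ENNReal.ofReal_mul (Nat.cast_nonneg n), ENNReal.ofReal_natCast]
          ring
  have hpost : μ₂ {p : sphere (0 : EuclideanSpace ℝ d) 1 × EuclideanSpace ℝ d |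
      ‖p.2‖ ≤ E ∧ ((p.1 : EuclideanSpace ℝ d), p.2) ∈ bgsrPostBadSet t ā ε₀ δ W Y m} ≤
      ENNReal.ofReal cpost * B ^ 2 :=
    sphereMeasure_prod_bgsrPostBadSet_le hā hāε₀ hε₀12 hδ hW ht hE hlam hd hsep
  calc _ ≤ μ₂ (univ ×ˢ bgsrPreBadVel t ā ε₀ δ W Y m ∪
        {p | ‖p.2‖ ≤ E ∧ ((p.1 : EuclideanSpace ℝ d), p.2) ∈ bgsrPostBadSet t ā ε₀ δ W Y m}) :=
        measure_mono hincl
    _ ≤ _ := measure_union_le _ _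
    _ ≤ ENNReal.ofReal (n * cpre) * B ^ 2 + ENNReal.ofReal cpost * B ^ 2 := add_le_add hpre hpost
    _ = ENNReal.ofReal (n * cpre + cpost) * B ^ 2 := by
        rw [ENNReal.ofReal_add (by positivity) hcpost0, add_mul]
    _ = _ := by
        congr 2
        rw [hcpre_def, hcpost_def]
        ring

end BadSet

end

end Literature.MathematicalPhysics.KineticTheory
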